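import Summits.MatrixMultiplication.OmegaCensus.STPP222IcosetHSearch
import Mathlib.Tactic.IntervalCases

/-!
# ω-census, icoset class negatives: kernel evaluation chunks for `𝔽₂³ × ℤ₁₁`, `K = 6` (part A2: `b₁ = 1`, `c₁ ∈ {5,6,7}`)

HONEST FRAMING (pub-omega census; verbatim): lottery ticket; floor = certified bounds/negative ranges.
Census STRUCTURE bookkeeping (Q7), nothing about `ω`.  Pure kernel evaluations of `IcosetH.checkFrom (cyc 11) 6 x y` (the subtree of the
H-stage search below the level-1 choice `(b₁, c₁) = (x, y)`; engine `STPP222IcosetHSearch.lean`, soundness `STPP222IcosetHSearchSound.lean`),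
one `decide +kernel` per `(x, y)` with ≥ 300 search nodes, light ones grouped; the parts are assembled into `IcosetH.check (cyc 11) 6 = true`
and the class negative in `STPP222IcosetClassNoneK6Z11.lean`.  Node counts (seat prototype = ENG2 icoset3; 151 112 in all; ≈ 8 ms/node on the
farm): (1,5): 6064, (1,6): 5454, (1,7): 6064 — this file 17582 nodes.  Seat pub-omega-kernel-l4 (gen 19), 2026-08-27.
-/

namespace Summit.MatrixMultiplication.OmegaCensus

namespace IcosetH

/-- Kernel evaluation of the `(b₁, c₁) = (1, 5)` subtree (6064 nodes). -/
theorem checkFrom_cyc11_1_5 : checkFrom (cyc 11) 6 1 5 = true := by decide +kernel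

/-- Kernel evaluation of the `(b₁, c₁) = (1, 6)` subtree (5454 nodes). -/
theorem checkFrom_cyc11_1_6 : checkFrom (cyc 11) 6 1 6 = true := by decide +kernel

/-- Kernel evaluation of the `(b₁, c₁) = (1, 7)` subtree (6064 nodes). -/
theorem checkFrom_cyc11_1_7 : checkFrom (cyc 11) 6 1 7 = true := by decide +kernel

end IcosetH

end Summit.MatrixMultiplication.OmegaCensus
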